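import Summits.CriticalPhenomena.PercolationContinuityZ3.Theorems.PercNearOneGluingNoHeavyLowerTailIncStarThetaSameBranch
import Summits.CriticalPhenomena.PercolationContinuityZ3.Theorems.PercNearOneGluingNoHeavyLowerTailIncStarThetaDiffBranch
import Summits.CriticalPhenomena.PercolationContinuityZ3.Theorems.PercNearOneGluingNoHeavyLowerTailIncStarBranchLemma
import HarnessLib

/-!
# THEOREM Θ′ (two-target branch lemma): `Θ′ ≥ 0` on every apex-forest

Support file for the Sahi programme (`--supports stmt-CriticalPhenomena-4575`, prover prim-sahi-p2 gen 19).  No definitions, no named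
facts, no sorries; standard axioms.  Memo `prim-sahi-p2/PROOF-E3.md` (29l)–(29m).

**Theorem `theta_nonneg`.**  For product Bernoulli percolation on the pairs of `Fin n` with root `s`, every port `v ≠ s` and all targets
`b, c`: if the environment `fromEdgeSet {z | s ∉ z ∧ w z ≠ 0}` is acyclic then
`Θ′(w; v; b, c) = Ξ_b + Ξ_c + D_bc − ½(D_b·m_c + D_c·m_b) − D_bD_c ≥ 0` (notation of `…IncStarThetaDiffBranch`).  At the port (`b = v`)
this is half the branch lemma `D_c + 2H_c − A·Z_c ≥ 0` (`IncStar.branchLemma`), of which it is the two-target extension; it feeds the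
same-branch step of the R-side lemma of THEOREM C½ (PROOF-E3 (29l)).  Exact brute force on random apex-forests: 0 violations in 1050
instances, minimum exactly 0 (gen19 `psi_check.py`).

**Proof.**  Induction on the number of positive environment pairs, over all ports (the scheme of `IncStar.psi_nonneg`).  `b = v`: the branch
lemma; `c = v`: symmetry; `b` outside the tree of `v`: `Θ′ = ½D_c·m_b` (independence through the root) or `0`; `c` likewise; otherwise, with
`x_b` the neighbour of `v` towards `b`: if `c` lies behind the bridge `s(x_b, v)` the same-branch step `IncStar.theta_bridge_step_sameBranch`
and the induction hypothesis at the port `x_b` of `w[s(x_b,v)↦0]`, else `IncStar.theta_bridge_step_diffBranch` with the branch lemmas at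
`(x_b, b)` and `(v, c)` under `w[s(x_b,v)↦0]`.
-/

noncomputable section

namespace Summit.CriticalPhenomena.PercolationContinuityZ3.Theorems

namespace IncStar

open MeasureTheory Set Literature.Probability.Percolation Literature.Probability.LatticeModels EdgeInduction
open scoped Classical

variable {n : ℕ}

/-- `Θ′` is symmetric in the two targets. [this work] -/
theorem theta_symm (w : Sym2 (Fin n) → unitInterval) (s v b c : Fin n) :
    (prodBernoulli w).real ((openConn b v \ openConn s v) ∩ openConn s c)
        + (prodBernoulli w).real ((openConn c v \ openConn s v) ∩ openConn s b) + (prodBernoulli w).real ((openConn b v ∩ openConn c v) \ openConn s v)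
        - 1 / 2 * ((prodBernoulli w).real (openConn b v \ openConn s v) * (prodBernoulli w).real (openConn s c)
            + (prodBernoulli w).real (openConn c v \ openConn s v) * (prodBernoulli w).real (openConn s b))
        - (prodBernoulli w).real (openConn b v \ openConn s v) * (prodBernoulli w).real (openConn c v \ openConn s v)
    = (prodBernoulli w).real ((openConn c v \ openConn s v) ∩ openConn s b)
        + (prodBernoulli w).real ((openConn b v \ openConn s v) ∩ openConn s c) + (prodBernoulli w).real ((openConn c v ∩ openConn b v) \ openConn s v)
        - 1 / 2 * ((prodBernoulli w).real (openConn c v \ openConn s v) * (prodBernoulli w).real (openConn s b)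
            + (prodBernoulli w).real (openConn b v \ openConn s v) * (prodBernoulli w).real (openConn s c))
        - (prodBernoulli w).real (openConn c v \ openConn s v) * (prodBernoulli w).real (openConn b v \ openConn s v) := by
  rw [Set.inter_comm (openConn b v) (openConn c v)]
  ring

/-- **`Θ′` at the port** (`b = v`): `Θ′ = ½(D_c + 2H_c − A·Z_c) ≥ 0` by the branch lemma. [this work] -/
theorem theta_port (w : Sym2 (Fin n) → unitInterval) {s v : Fin n} (c : Fin n) (hv : v ≠ s)
    (hforest : (SimpleGraph.fromEdgeSet {z : Sym2 (Fin n) | s ∉ z ∧ w z ≠ 0}).IsAcyclic) :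
    0 ≤ (prodBernoulli w).real ((openConn v v \ openConn s v) ∩ openConn s c)
        + (prodBernoulli w).real ((openConn c v \ openConn s v) ∩ openConn s v) + (prodBernoulli w).real ((openConn v v ∩ openConn c v) \ openConn s v)
        - 1 / 2 * ((prodBernoulli w).real (openConn v v \ openConn s v) * (prodBernoulli w).real (openConn s c)
            + (prodBernoulli w).real (openConn c v \ openConn s v) * (prodBernoulli w).real (openConn s v))
        - (prodBernoulli w).real (openConn v v \ openConn s v) * (prodBernoulli w).real (openConn c v \ openConn s v) := by
  have hm : ∀ X : Set (BondConfig (Fin n)), MeasurableSet X := fun _ => MeasurableSet.of_discrete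
  have Br := branchLemma w c hv hforest
  have hvv : (openConn v v : Set (BondConfig (Fin n))) = Set.univ := Set.eq_univ_of_forall fun _ => SimpleGraph.Reachable.refl v
  have e1 : (Set.univ \ openConn s v : Set (BondConfig (Fin n))) = (openConn s v)ᶜ := (Set.compl_eq_univ_sdiff _).symm
  have e2 : ((openConn s v)ᶜ ∩ openConn s c : Set (BondConfig (Fin n))) = (openConn s v)ᶜ ∩ (openConn c v)ᶜ ∩ openConn s c := by
    ext ω
    simp only [Set.mem_inter_iff, Set.mem_compl_iff]
    constructor
    · rintro ⟨hsv, hsc⟩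
      exact ⟨⟨hsv, fun hcv => hsv (SimpleGraph.Reachable.trans hsc hcv)⟩, hsc⟩
    · rintro ⟨⟨hsv, -⟩, hsc⟩
      exact ⟨hsv, hsc⟩
  have e3 : ((openConn c v \ openConn s v) ∩ openConn s v : Set (BondConfig (Fin n))) = ∅ := by
    ext ω; simp only [Set.mem_inter_iff, Set.mem_sdiff, Set.mem_empty_iff_false, iff_false]; tauto
  have hσ : (prodBernoulli w).real (openConn s v) = 1 - (prodBernoulli w).real (openConn s v)ᶜ := by
    rw [probReal_compl_eq_one_sub (hm _)]; ring
  have hZ : (prodBernoulli w).real (openConn c v ∪ openConn s c)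
      = (prodBernoulli w).real (openConn s c) + (prodBernoulli w).real (openConn c v \ openConn s v) := by
    rw [← measureReal_union ?_ (hm _)]
    · congr 1
      ext ω
      simp only [Set.mem_union, Set.mem_sdiff]
      constructor
      · rintro (hcv | hsc)
        · by_cases hsv : ω ∈ openConn s v
          · exact Or.inl (SimpleGraph.Reachable.trans hsv (SimpleGraph.Reachable.symm hcv))
          · exact Or.inr ⟨hcv, hsv⟩
        · exact Or.inl hsc
      · rintro (hsc | ⟨hcv, -⟩)
        · exact Or.inr hsc
        · exact Or.inl hcv
    · exact Set.disjoint_left.2 fun ω hsc h => h.2 (SimpleGraph.Reachable.trans hsc h.1)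
  rw [hvv, e1, Set.univ_inter, e2, e3, measureReal_empty, hσ]
  rw [hZ] at Br
  have eB : (prodBernoulli w).real (openConn s v)ᶜ * ((prodBernoulli w).real (openConn s c) + (prodBernoulli w).real (openConn c v \ openConn s v))
      = (prodBernoulli w).real (openConn s v)ᶜ * (prodBernoulli w).real (openConn s c)
        + (prodBernoulli w).real (openConn s v)ᶜ * (prodBernoulli w).real (openConn c v \ openConn s v) := by ring
  linarith

/-- **`Θ′` when `b` lies outside the tree of the port**: `Θ′ = ½D_c·m_b` (independence through the root) if `c` is in the tree, else `0`.
[this work] -/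
theorem theta_of_not_reachable (w : Sym2 (Fin n) → unitInterval) {s v b : Fin n} (c : Fin n) (hv : v ≠ s)
    (hb : ¬ (SimpleGraph.fromEdgeSet {z : Sym2 (Fin n) | s ∉ z ∧ w z ≠ 0}).Reachable v b) :
    0 ≤ (prodBernoulli w).real ((openConn b v \ openConn s v) ∩ openConn s c)
        + (prodBernoulli w).real ((openConn c v \ openConn s v) ∩ openConn s b) + (prodBernoulli w).real ((openConn b v ∩ openConn c v) \ openConn s v)
        - 1 / 2 * ((prodBernoulli w).real (openConn b v \ openConn s v) * (prodBernoulli w).real (openConn s c)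
            + (prodBernoulli w).real (openConn c v \ openConn s v) * (prodBernoulli w).real (openConn s b))
        - (prodBernoulli w).real (openConn b v \ openConn s v) * (prodBernoulli w).real (openConn c v \ openConn s v) := by
  set H := SimpleGraph.fromEdgeSet {z : Sym2 (Fin n) | s ∉ z ∧ w z ≠ 0} with hH
  set L : Set (Fin n) := {x | (H.deleteEdges ∅).Reachable v x}
  have hsL : s ∉ L := apexForest_root_not_mem w hv _
  have hvL : v ∈ L := SimpleGraph.Reachable.refl v
  have hbL : b ∉ L := fun h => hb (h.mono (SimpleGraph.deleteEdges_le _))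
  have hs1 : s ∈ insert s L := Set.mem_insert s L
  have hv1 : v ∈ insert s L := Set.mem_insert_of_mem s hvL
  have hcross : ∀ x y : Fin n, x ∈ L → y ∉ L → y ≠ s → w s(x, y) = 0 :=
    fun x y hx hy hys => apexForest_cross w hv ∅ hx hy hys (Set.notMem_empty _)
  set G : Set (BondConfig (Fin n)) := {ω | ∀ e', w e' = 0 → e' ∉ ω}
  have hG1 : (prodBernoulli w).real G = 1 := real_sureClosed w
  have hωG : ∀ ω ∈ G, ∀ x y : Fin n, x ∈ L → y ∉ L → y ≠ s → s(x, y) ∉ ω :=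
    fun ω hω x y hx hy hys => hω _ (hcross x y hx hy hys)
  have hm : ∀ X : Set (BondConfig (Fin n)), MeasurableSet X := fun _ => MeasurableSet.of_discrete
  set Vn : Set (BondConfig (Fin n)) := openConnIn (insert s L) s v
  set Bf : Set (BondConfig (Fin n)) := openConnIn Lᶜ s b
  have c_sv : ∀ ω ∈ G, (ω ∈ openConn s v ↔ ω ∈ Vn) := fun ω hω => bridge_conn_ll L hsL (hωG ω hω) hs1 hv1
  have c_sb : ∀ ω ∈ G, (ω ∈ openConn s b ↔ ω ∈ Bf) := fun ω hω => by
    rw [bridge_conn_lr L hsL (hωG ω hω) hs1 hbL]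
    exact ⟨fun h => h.2, fun h => ⟨⟨hs1, hs1, SimpleGraph.Reachable.refl _⟩, h⟩⟩
  have c_bv : ∀ ω ∈ G, (ω ∈ openConn b v ↔ ω ∈ Bf ∧ ω ∈ Vn) := fun ω hω => by
    rw [bridge_conn_rl L hsL (hωG ω hω) hbL hv1]
    exact ⟨fun h => ⟨openConnIn_symm' h.1, h.2⟩, fun h => ⟨openConnIn_symm' h.1, h.2⟩⟩
  have hdiff : ∀ {A B : Set (BondConfig (Fin n))} {K' : Set (Sym2 (Fin n))},
      DeterminedBy A K' → DeterminedBy B K' → DeterminedBy (A \ B) K' := by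
    intro A B K' hA hB
    rw [determinedBy_iff] at hA hB ⊢
    intro ω ω' h
    rw [Set.mem_sdiff, Set.mem_sdiff, hA ω ω' h, hB ω ω' h]
  have zero_of_empty : ∀ {A : Set (BondConfig (Fin n))}, (∀ ω ∈ G, ω ∉ A) → (prodBernoulli w).real A = 0 := by
    intro A hA
    have h : (prodBernoulli w).real A = (prodBernoulli w).real (∅ : Set (BondConfig (Fin n))) :=
      real_congr_of_sure hG1 fun ω hω => ⟨fun h => (hA ω hω h).elim, fun h => (Set.notMem_empty _ h).elim⟩
    rw [h, measureReal_empty]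
  have eDb : (prodBernoulli w).real (openConn b v \ openConn s v) = 0 :=
    zero_of_empty fun ω hω h => by rw [Set.mem_sdiff, c_bv ω hω, c_sv ω hω] at h; exact h.2 h.1.2
  have eDbc : (prodBernoulli w).real ((openConn b v ∩ openConn c v) \ openConn s v) = 0 :=
    zero_of_empty fun ω hω h => by rw [Set.mem_sdiff, Set.mem_inter_iff, c_bv ω hω, c_sv ω hω] at h; exact h.2 h.1.1.2
  have eXb : (prodBernoulli w).real ((openConn b v \ openConn s v) ∩ openConn s c) = 0 :=
    zero_of_empty fun ω hω h => by rw [Set.mem_inter_iff, Set.mem_sdiff, c_bv ω hω, c_sv ω hω] at h; exact h.1.2 h.1.1.2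
  have emb : (prodBernoulli w).real (openConn s b) = (prodBernoulli w).real Bf := real_congr_of_sure hG1 c_sb
  rw [eDb, eDbc, eXb, emb]
  by_cases hcL : c ∈ L
  · have hc1 : c ∈ insert s L := Set.mem_insert_of_mem s hcL
    set Cn : Set (BondConfig (Fin n)) := openConnIn (insert s L) c v
    have c_cv : ∀ ω ∈ G, (ω ∈ openConn c v ↔ ω ∈ Cn) := fun ω hω => bridge_conn_ll L hsL (hωG ω hω) hc1 hv1
    have eDc : (prodBernoulli w).real (openConn c v \ openConn s v) = (prodBernoulli w).real (Cn \ Vn) :=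
      real_congr_of_sure hG1 fun ω hω => by rw [Set.mem_sdiff, Set.mem_sdiff, c_cv ω hω, c_sv ω hω]
    have eXc : (prodBernoulli w).real ((openConn c v \ openConn s v) ∩ openConn s b)
        = (prodBernoulli w).real (Cn \ Vn) * (prodBernoulli w).real Bf := by
      rw [← indep_blocks w L s (hdiff (IncStarCutVertex.determinedBy_openConnIn_offDiag _ c v)
        (IncStarCutVertex.determinedBy_openConnIn_offDiag _ s v)) (IncStarCutVertex.determinedBy_openConnIn_offDiag _ s b)]
      refine real_congr_of_sure hG1 fun ω hω => ?_
      rw [Set.mem_inter_iff, Set.mem_inter_iff, Set.mem_sdiff, Set.mem_sdiff, c_cv ω hω, c_sv ω hω, c_sb ω hω]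
    rw [eDc, eXc]
    have hD : 0 ≤ (prodBernoulli w).real (Cn \ Vn) := measureReal_nonneg
    have hB : 0 ≤ (prodBernoulli w).real Bf := measureReal_nonneg
    nlinarith [mul_nonneg hD hB]
  · have c_cv : ∀ ω ∈ G, (ω ∈ openConn c v ↔ ω ∈ openConnIn Lᶜ c s ∧ ω ∈ Vn) := fun ω hω =>
      bridge_conn_rl L hsL (hωG ω hω) hcL hv1
    have eDc : (prodBernoulli w).real (openConn c v \ openConn s v) = 0 :=
      zero_of_empty fun ω hω h => by rw [Set.mem_sdiff, c_cv ω hω, c_sv ω hω] at h; exact h.2 h.1.2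
    have eXc : (prodBernoulli w).real ((openConn c v \ openConn s v) ∩ openConn s b) = 0 :=
      zero_of_empty fun ω hω h => by rw [Set.mem_inter_iff, Set.mem_sdiff, c_cv ω hω, c_sv ω hω] at h; exact h.1.2 h.1.1.2
    rw [eDc, eXc]
    norm_num

/-- **THEOREM Θ′ (two-target branch lemma): `Θ′ ≥ 0` on every apex-forest**, for every port `v ≠ s` and all targets (PROOF-E3 (29l)–(29m)).
[this work] -/
theorem theta_nonneg (w : Sym2 (Fin n) → unitInterval) {s v : Fin n} (b c : Fin n) (hv : v ≠ s)
    (hforest : (SimpleGraph.fromEdgeSet {z : Sym2 (Fin n) | s ∉ z ∧ w z ≠ 0}).IsAcyclic) :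
    0 ≤ (prodBernoulli w).real ((openConn b v \ openConn s v) ∩ openConn s c)
        + (prodBernoulli w).real ((openConn c v \ openConn s v) ∩ openConn s b) + (prodBernoulli w).real ((openConn b v ∩ openConn c v) \ openConn s v)
        - 1 / 2 * ((prodBernoulli w).real (openConn b v \ openConn s v) * (prodBernoulli w).real (openConn s c)
            + (prodBernoulli w).real (openConn c v \ openConn s v) * (prodBernoulli w).real (openConn s b))
        - (prodBernoulli w).real (openConn b v \ openConn s v) * (prodBernoulli w).real (openConn c v \ openConn s v) := by
  suffices hN : ∀ (N : ℕ) (w : Sym2 (Fin n) → unitInterval) (v b c : Fin n), v ≠ s →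
      (SimpleGraph.fromEdgeSet {z : Sym2 (Fin n) | s ∉ z ∧ w z ≠ 0}).IsAcyclic →
      (Finset.univ.filter fun z : Sym2 (Fin n) => ¬ z.IsDiag ∧ s ∉ z ∧ w z ≠ 0).card ≤ N →
      0 ≤ (prodBernoulli w).real ((openConn b v \ openConn s v) ∩ openConn s c)
        + (prodBernoulli w).real ((openConn c v \ openConn s v) ∩ openConn s b) + (prodBernoulli w).real ((openConn b v ∩ openConn c v) \ openConn s v)
        - 1 / 2 * ((prodBernoulli w).real (openConn b v \ openConn s v) * (prodBernoulli w).real (openConn s c)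
            + (prodBernoulli w).real (openConn c v \ openConn s v) * (prodBernoulli w).real (openConn s b))
        - (prodBernoulli w).real (openConn b v \ openConn s v) * (prodBernoulli w).real (openConn c v \ openConn s v) from
    hN _ w v b c hv hforest le_rfl
  intro N
  induction N with
  | zero =>
    intro w v b c hv hforest hN
    exact theta_step w hv hforest fun w' _ hlt _ _ => by omega
  | succ N ih =>
    intro w v b c hv hforest hN
    exact theta_step w hv hforest fun w' hf hlt v' hv' => ih w' v' b c hv' hf (by omega)
where
  /-- The inductive step (all cases). -/
  theta_step (w : Sym2 (Fin n) → unitInterval) {s v b c : Fin n} (hv : v ≠ s)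
      (hforest : (SimpleGraph.fromEdgeSet {z : Sym2 (Fin n) | s ∉ z ∧ w z ≠ 0}).IsAcyclic)
      (IH : ∀ w' : Sym2 (Fin n) → unitInterval,
        (SimpleGraph.fromEdgeSet {z : Sym2 (Fin n) | s ∉ z ∧ w' z ≠ 0}).IsAcyclic →
        (Finset.univ.filter fun z : Sym2 (Fin n) => ¬ z.IsDiag ∧ s ∉ z ∧ w' z ≠ 0).card
          < (Finset.univ.filter fun z : Sym2 (Fin n) => ¬ z.IsDiag ∧ s ∉ z ∧ w z ≠ 0).card →
        ∀ v' : Fin n, v' ≠ s → 0 ≤ (prodBernoulli w').real ((openConn b v' \ openConn s v') ∩ openConn s c)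
            + (prodBernoulli w').real ((openConn c v' \ openConn s v') ∩ openConn s b) + (prodBernoulli w').real ((openConn b v' ∩ openConn c v') \ openConn s v')
            - 1 / 2 * ((prodBernoulli w').real (openConn b v' \ openConn s v') * (prodBernoulli w').real (openConn s c)
                + (prodBernoulli w').real (openConn c v' \ openConn s v') * (prodBernoulli w').real (openConn s b))
            - (prodBernoulli w').real (openConn b v' \ openConn s v') * (prodBernoulli w').real (openConn c v' \ openConn s v')) :
      0 ≤ (prodBernoulli w).real ((openConn b v \ openConn s v) ∩ openConn s c)
        + (prodBernoulli w).real ((openConn c v \ openConn s v) ∩ openConn s b) + (prodBernoulli w).real ((openConn b v ∩ openConn c v) \ openConn s v)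
        - 1 / 2 * ((prodBernoulli w).real (openConn b v \ openConn s v) * (prodBernoulli w).real (openConn s c)
            + (prodBernoulli w).real (openConn c v \ openConn s v) * (prodBernoulli w).real (openConn s b))
        - (prodBernoulli w).real (openConn b v \ openConn s v) * (prodBernoulli w).real (openConn c v \ openConn s v) := by
    by_cases hbv : b = v
    · subst hbv; exact theta_port w c hv hforest
    by_cases hcv : c = v
    · subst hcv; rw [theta_symm]; exact theta_port w b hv hforest
    set H := SimpleGraph.fromEdgeSet {z : Sym2 (Fin n) | s ∉ z ∧ w z ≠ 0} with hH
    by_cases hrb : H.Reachable v b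
    swap
    · exact theta_of_not_reachable w c hv hrb
    by_cases hrc : H.Reachable v c
    swap
    · rw [theta_symm]; exact theta_of_not_reachable w b hv hrc
    -- neighbour of `v` towards `b`
    have key : ∀ (t : Fin n), t ≠ v → ∀ q : H.Walk v t, q.IsPath →
        ∃ x : Fin n, H.Adj v x ∧ ∃ r : H.Walk x t, v ∉ r.support := by
      intro t ht q hq
      cases q with
      | nil => exact absurd rfl ht
      | cons hadj r =>
        rename_i x
        exact ⟨x, hadj, r, ((SimpleGraph.Walk.cons_isPath_iff hadj r).1 hq).2⟩
    obtain ⟨pb⟩ := hrb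
    obtain ⟨xb, hadjb, rb, hrb'⟩ := key b hbv pb.bypass pb.bypass_isPath
    have hxbs : xb ≠ s := by
      intro h; rw [hH, SimpleGraph.fromEdgeSet_adj] at hadjb; exact hadjb.1.1 (h ▸ Sym2.mem_mk_right v xb)
    have hadjb' : H.Adj xb v := hadjb.symm
    have hbridge : ¬ (H.deleteEdges {s(xb, v)}).Reachable xb v :=
      SimpleGraph.isBridge_iff.1 (SimpleGraph.isAcyclic_iff_forall_adj_isBridge.1 hforest hadjb')
    have avoid : ∀ {x t : Fin n} (r : H.Walk x t), v ∉ r.support → (H.deleteEdges {s(xb, v)}).Reachable x t := by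
      intro x t r hr
      exact SimpleGraph.reachable_deleteEdges_iff_exists_walk.2 ⟨r, fun he => hr (r.snd_mem_support_of_mem_edges he)⟩
    set L : Set (Fin n) := {x | (H.deleteEdges {s(xb, v)}).Reachable xb x}
    have hsL : s ∉ L := apexForest_root_not_mem w hxbs _
    have hxL : xb ∈ L := SimpleGraph.Reachable.refl xb
    have hvL : v ∉ L := hbridge
    have hbL : b ∈ L := avoid rb hrb'
    have hcross : ∀ x y : Fin n, x ∈ L → y ∉ L → y ≠ s → s(x, y) ≠ s(xb, v) → w s(x, y) = 0 :=
      fun x y hx hy hys hne => apexForest_cross w hxbs {s(xb, v)} hx hy hys (by rwa [Set.mem_singleton_iff])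
    have hz : s(xb, v) ∈ Finset.univ.filter (fun z : Sym2 (Fin n) => ¬ z.IsDiag ∧ s ∉ z ∧ w z ≠ 0) := by
      rw [hH, SimpleGraph.fromEdgeSet_adj] at hadjb'
      simp only [Finset.mem_filter, Finset.mem_univ, true_and, Sym2.mk_isDiag_iff]
      exact ⟨hadjb'.2, hadjb'.1.1, hadjb'.1.2⟩
    have hforest0 : (SimpleGraph.fromEdgeSet {z : Sym2 (Fin n) | s ∉ z ∧ Function.update w s(xb, v) 0 z ≠ 0}).IsAcyclic :=
      hforest.anti (envGraph_update_le w s _ 0 (Or.inr rfl))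
    by_cases hcL : c ∈ L
    · -- same branch
      exact theta_bridge_step_sameBranch w L hsL hxL hvL hbL hcL hcross
        (IH _ hforest0 (posEnv_card_update_lt w s hz) xb hxbs)
    · -- `c` not behind the bridge
      exact theta_bridge_step_diffBranch w L hsL hxL hvL hbL hcL hcross
        (branchLemma (Function.update w s(xb, v) 0) b hxbs hforest0)
        (branchLemma (Function.update w s(xb, v) 0) c hv hforest0)

end IncStar

end Summit.CriticalPhenomena.PercolationContinuityZ3.Theorems
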